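import Summits.HodgeConjecture.CorCM.CyclicSexticFaceMonomialSpan
import Summits.HodgeConjecture.CorCM.CyclicSexticFaceWeilTypeCount
import Summits.HodgeConjecture.CorCM.CyclicSexticFaces
import Summits.HodgeConjecture.CorCM.WeilFourfoldOfMarkmanPlane
import Summits.HodgeConjecture.CorCM.WeilLineMonomials
import Summits.HodgeConjecture.CorCM.CM.Lemmas
import HarnessLib

/-!
# COR-CM (cell `pub-hodgecm2`), A1 line — step L5 (main): the face monomials of the four corner
# realisations of a cyclic-sextic face are ALGEBRAIC, given Markman's fourfold theorem (mod `hR`, `h₃`)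

HONEST FRAMING (cell pub-hodgecm2 / COR-CM, seat b30 gen 11; COUNT-NEUTRAL — no binder row of
`HOME/BINDER-OWNERS.md`; the conclusion is CONDITIONAL on the displayed named fact
`HodgeTheory.Markman2025_weilClasses_algebraic_abelianFourfold` (B2b floor R1) and on the cell's displayed binders
`hR` (Riemann's theorem, B02) and `h₃` (CM realisations exist); nothing else is assumed).  This is FINDING F-6 /
step L5 of `HOME/pub-hodgecm2-lit-andre-3/A1-BLUEPRINT.md` and `PORTFOLIO-lit-andre-3-g2.md` §2 (S1)–(S2) on the
tree's real carriers:

Let `K` be a Galois CM field of degree `6` (cyclic: `σ` of order `6`, `σ³ = ρ`, `k = K^{⟨σ²⟩}` imaginary quadratic),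
and `Ψ : Fin 4 → CMType K` four CM types in the pattern (F) of `CyclicSextic.sumTwo_pattern` — a `σ²`-stable corner
`Ψ j₀` and three primitive corners `Ψ j₁`, `Ψ j₂ = Ψ j₁ ∘ σ²`, `Ψ j₃ = Ψ j₁ ∘ σ⁴` — with constant indicator sum `2`,
realised by `(A j, ι j, θ j)`.  Then for every embedding `s : K → ℂ` and all `s`-eigenvectors `y_j ∈ H¹(A_j)` the
FACE MONOMIAL `π₀^*y₀ ⌣ π₁^*y₁ ⌣ π₂^*y₂ ⌣ π₃^*y₃ ∈ H⁴(⨁ A_j)` is an algebraic class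
(`cupPowOne_eigenline_mem_algebraicClasses_of_markman`).

Proof (S1)–(S2): `Y := A_{j₁} ⊞ E` with `E` a CM elliptic curve of `k` and `ν : A_{j₀} → E` `𝓞_k`-equivariant
(Shimura's inflation, `thm3_isogenousPower_of_riemann`), twist isogenies `u₂ : A_{j₂} → A_{j₁}`, `u₃ : A_{j₃} → A_{j₁}`
(`exists_twistIsogeny_eigenline_of_riemann`); the Weil plane of `Y` is algebraic (seat b24's
`WeilFourfold.weilClassesOf_le_algebraicClasses_cmThreefold_biprod_cmCurve` with `CyclicSextic.weilTypeCount_of_pattern`); the span `V` of its pull-backs along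
`h_b = (π_{j₁} ι(b₀) + π_{j₂} ι(b₁) u₂ + π_{j₃} ι(b₂) u₃, π_{j₀} ι(b₃) ν)` is algebraic and stable under the diagonal
`𝓞_K`-action (`diagHom_comp_liftFamily`, file `CyclicSexticFaceMonomialSpan.lean`); for a separating integer `a₀`
and a generic shift `t` the diagonal action of `a₀ + t` is diagonal on the wedge basis of `H⁴(⨁ A)` with the
eigenvalue `(s(a₀)+t)⁴` occurring ONLY on the face-monomial line (`exists_diag_separating_face`, same file); the face-monomial coordinate of
`h_1^*(fst^*e_s ⌣ fst^*e_{s∘σ²} ⌣ fst^*e_{s∘σ⁴} ⌣ snd^*ℓ_{s|k})` is the determinant of a monomial matrix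
(`repr_map_lift_map_fst/_snd` of `CyclicSexticFaceMonomialSpan.lean`), hence non-zero; so the face monomial lies in `V` (`basis_mem_of_invariant_of_repr_ne_zero`).

Consequences (step L6 (F-branch) and T1 for faces): `weilLineClasses_le_algebraicClasses_of_patternF` — the
complexified `K`-Weil line `weilLineClasses A ι 4` of an (F)-pattern slot family is algebraic (it is the sum of the
monomial lines `ℂ · μ_s`, seat p2's `WeilLineMonomial.weilLineClasses_eq_iSup_span_monomial`);
`weilLineClasses_corner_le_algebraicClasses_of_markman` — the same for the four CORNERS of every rank-four face
(every face is in pattern (F): seat b24's `face_corner_pattern`; `sumTwo_corner`), i.e. the hypothesis `hW` of seat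
b07's model junction `Model.weilFaceAlgebraic_of_weilLineClasses_le`, and its pointwise form.  The (P)-branch and
the SumTwo-general / André `hW` statements follow in a sequel over seat p2's `WeilLinePairsAlgebraic.lean`.

THEOREMS ONLY; no `sorry`; axioms `propext`, `Classical.choice`, `Quot.sound`.

## References
* [Markman2025SurveySecant] E. Markman, arXiv:2509.23403, Thm. 1.2 (the displayed hypothesis).
* [Andre1992HodgeCM] Y. André, Progr. Math. 102 (1992), p. 2 (Weil classes ⇒ Hodge conjecture for CM type).
* [Shimura1998] G. Shimura, *Abelian Varieties with Complex Multiplication and Modular Functions* (1998), §6.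
* [MoonenZarhin1998WeilClasses] B. Moonen, Yu. Zarhin, J. reine angew. Math. 496 (1998), §1 (Weil classes `W_K`).
* [LangeBirkenhake1992] H. Lange, Ch. Birkenhake, *Complex Abelian Varieties* (1992), §1.1.
-/

noncomputable section

namespace Summit.HodgeConjecture.CorCM.CyclicSextic

open CategoryTheory CategoryTheory.Limits NumberField
open Literature.AlgebraicTopology.SingularHomology
open Literature.AlgebraicGeometry Literature.AlgebraicGeometry.Motives Literature.AlgebraicGeometry.HodgeTheory
open Literature.AlgebraicGeometry.ComplexMultiplication
open Literature.NumberTheory.ComplexMultiplication (conjGal inducedCMType mem_inducedCMType_iff)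
open Literature.NumberTheory.Automorphic.PicardCM (eigenline)
open Literature.NumberTheory.Automorphic.PicardCM.CMCode (cmTypeMap mem_cmTypeMap_iff)
open Summit.HodgeConjecture.HodgeConjecture.Theorems.HodgeAbelianVarieties.CMPivotAndre

variable {K : Type} [Field K] [NumberField K] [IsCMField K] [IsGalois ℚ K]

/-! ## The main theorem -/

section Main

/-- **FINDING F-6 / A1 step L5 (face monomials of a cyclic-sextic face are algebraic, given Markman).**  See the
module docstring.  Hypotheses: `hW4` Markman's fourfold theorem (named fact, displayed); `hR` Riemann's theorem
(displayed binder B02 of the cell); `h₃` existence of CM realisations (displayed); `K` Galois CM of degree `6` with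
`σ` of order `6`, `σ³ = ρ`; slots `j₀ j₁ j₂ j₃` pairwise distinct with `Ψ j₀` `σ²`-stable, `Ψ j₂ = (Ψ j₁)^{σ²}`,
`Ψ j₃ = (Ψ j₁)^{σ⁴}`, constant indicator sum `2`; realisations `(A j, ι j, θ j)`; `y j` in the `s`-eigenlines.
[cite: Markman2025SurveySecant, Thm. 1.2] [cite: Andre1992HodgeCM, p. 2]
[cite: Shimura1998, §6.1 Corollary of Theorem 2 and §6.2 Theorem 3] [cite: MoonenZarhin1998WeilClasses, §1] -/
theorem cupPowOne_eigenline_mem_algebraicClasses_of_markman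
    (hW4 : Markman2025_weilClasses_algebraic_abelianFourfold) (hR : DeligneMilne1982_Thm_6_20_full)
    (h₃ : Literature.NumberTheory.Automorphic.PicardCM.CMAbelianVarietyRealised)
    (h6 : Module.finrank ℚ K = 6) (σ : K ≃ₐ[ℚ] K) (hσ : orderOf σ = 6) (h3 : σ ^ 3 = conjGal)
    {A : Fin 4 → AbelianVariety ℂ} {ι : ∀ j, 𝓞 K →+* End (A j)}
    {θ : ∀ j, K →+* Module.End ℂ (complexBetti (A j).X 1)} {Ψ : Fin 4 → CMType K}
    (hA : ∀ j, IsCMTypeRealisation (Ψ j) (A j) (ι j) (θ j))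
    {j₀ j₁ j₂ j₃ : Fin 4} (hnd : [j₀, j₁, j₂, j₃].Nodup)
    (hΨ₀ : cmTypeMap (σ ^ 2).toRingEquiv (Ψ j₀) = Ψ j₀)
    (hΨ₂ : Ψ j₂ = cmTypeMap (σ ^ 2).toRingEquiv (Ψ j₁))
    (hΨ₃ : Ψ j₃ = cmTypeMap (σ ^ 4).toRingEquiv (Ψ j₁))
    (hsum : ∀ s : K →+* ℂ, {j : Fin 4 | s ∈ (Ψ j).1}.ncard = 2)
    (s : K →+* ℂ) (y : ∀ j, complexBetti (A j).X 1) (hy : ∀ j, y j ∈ eigenline (θ j) s) :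
    cupPowOne ℂ (ComplexPoints (⨁ A).X) (2 * 2)
        (fun j => complexBetti.map (biproduct.π A j).hom.hom.hom 1 (y j)) ∈ algebraicClasses (⨁ A).X 2 := by
  classical
  -- (0) the quadratic subfield, distinctness of the slots, eigenbases
  haveI : IsCMField (IntermediateField.fixedField (Subgroup.zpowers (σ ^ 2))) := isCMField_fixedField_sq σ hσ h3
  have h2 : Module.finrank ℚ (IntermediateField.fixedField (Subgroup.zpowers (σ ^ 2))) = 2 :=
    finrank_fixedField_sq σ h6 hσ
  have hnd' : (j₀ ≠ j₁ ∧ j₀ ≠ j₂ ∧ j₀ ≠ j₃) ∧ (j₁ ≠ j₂ ∧ j₁ ≠ j₃) ∧ j₂ ≠ j₃ := by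
    simpa [List.nodup_cons] using hnd
  obtain ⟨⟨h01, h02, h03⟩, ⟨h12, h13⟩, h23⟩ := hnd'
  have hv' : ∀ j, ∃ w : Module.Basis (K →+* ℂ) ℂ (complexBetti (A j).X 1), ∀ σ', w σ' ∈ eigenline (θ j) σ' :=
    fun j => AndreProductForm.exists_eigenbasis (hA j)
  choose v hv using hv'
  -- (1) the induced corner: `Ψ j₀ = Φ₀^K`, the CM elliptic curve `E`, `ν = g ≫ π_E jE`
  obtain ⟨Φ₀, hΦ₀⟩ := exists_inducedCMType_of_sq_stable σ (Ψ j₀) hΨ₀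
  have hA₀ : IsCMTypeRealisation
      (inducedCMType (algebraMap (IntermediateField.fixedField (Subgroup.zpowers (σ ^ 2))) K) Φ₀)
      (A j₀) (ι j₀) (θ j₀) := hΦ₀ ▸ hA j₀
  obtain ⟨E, ιE, θE, hE, h, P, πE, ⟨hlim⟩, g, hg, hcomm⟩ :=
    thm3_isogenousPower_of_riemann hR h₃ _ K
      (algebraMap (IntermediateField.fixedField (Subgroup.zpowers (σ ^ 2))) K) Φ₀ (A j₀) (ι j₀) (θ j₀) hA₀
  obtain ⟨vE, hvE⟩ := AndreProductForm.exists_eigenbasis hE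
  obtain ⟨jE, hjE⟩ := exists_repr_map_fan_ne_zero πE
    (algebraMap (IntermediateField.fixedField (Subgroup.zpowers (σ ^ 2))) K) (hA j₀) hE hlim hg hcomm
    (v j₀) (hv j₀) vE hvE s
  have hνcomm := fun a => hcomm jE a
  -- (2) `δ ∈ 𝓞_k` with `δ² = -d`, and its image `δB ∈ 𝓞_K`
  obtain ⟨δ, d, hd, hδ⟩ := exists_sq_eq_neg_nat_fixedField_sq σ h6 hσ h3
  have hδE : δ ^ 2 = -(d : 𝓞 (IntermediateField.fixedField (Subgroup.zpowers (σ ^ 2)))) := by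
    apply Subtype.ext
    exact hδ
  -- (3) twist isogenies `u₂ : A j₂ ⟶ A j₁`, `u₃ : A j₃ ⟶ A j₁`
  obtain ⟨u₂, -, hu₂bij, -, hu₂eig⟩ := exists_twistIsogeny_eigenline_of_riemann hR (hA j₁)
    (σ ^ 2).toRingEquiv (hΨ₂ ▸ hA j₂)
  obtain ⟨u₃, -, hu₃bij, -, hu₃eig⟩ := exists_twistIsogeny_eigenline_of_riemann hR (hA j₁)
    (σ ^ 4).toRingEquiv (hΨ₃ ▸ hA j₃)
  -- (4) the eigenvalue of the `s ∘ σ^{2m}`-lines of `A j₁` under `ι(δ)`, and the algebraic Weil plane of `Y`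
  have htδ : ∀ m : Fin 3, emb σ s (2 * (m : ℕ))
      ((RingOfIntegers.mapRingHom (algebraMap (IntermediateField.fixedField (Subgroup.zpowers (σ ^ 2))) K) δ
        : 𝓞 K) : K) =
      (s.comp (algebraMap (IntermediateField.fixedField (Subgroup.zpowers (σ ^ 2))) K))
        (δ : IntermediateField.fixedField (Subgroup.zpowers (σ ^ 2))) := by
    intro m
    rw [emb_apply, RingOfIntegers.mapRingHom_apply, pow_mul, RingHom.comp_apply]
    exact congrArg s (pow_sq_apply_of_mem σ m (δ : IntermediateField.fixedField (Subgroup.zpowers (σ ^ 2))).2)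
  have hΨ : SumTwo Ψ := (sumTwo_iff_ncard_eq_two Ψ).2 hsum
  have hWY := WeilFourfold.weilClassesOf_le_algebraicClasses_cmThreefold_biprod_cmCurve hW4 h6 h2
    (algebraMap (IntermediateField.fixedField (Subgroup.zpowers (σ ^ 2))) K) (hA j₁) hE hd hδ
    (fun τ => weilTypeCount_of_pattern σ hσ Ψ hΨ hnd hΦ₀ hΨ₂ hΨ₃ τ)
  -- (5) the family `h_b`, the span `V` of pull-backs of the Weil plane: algebraic and diag-stable
  let hfam : (Fin 4 → 𝓞 K) → ((⨁ A) ⟶ A j₁ ⊞ E) := fun b =>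
    biprod.lift (biproduct.π A j₁ ≫ ι j₁ (b 0) + biproduct.π A j₂ ≫ ι j₂ (b 1) ≫ u₂ +
        biproduct.π A j₃ ≫ ι j₃ (b 2) ≫ u₃)
      (biproduct.π A j₀ ≫ ι j₀ (b 3) ≫ (g ≫ πE jE))
  let WY := weilClassesOf (A j₁ ⊞ E)
    (biprod.map (ι j₁ (RingOfIntegers.mapRingHom
      (algebraMap (IntermediateField.fixedField (Subgroup.zpowers (σ ^ 2))) K) δ)) (ιE δ)) 2 d
  let V : Submodule ℂ (complexBetti (⨁ A).X (2 * 2)) :=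
    ⨆ b, WY.map (complexBetti.map (hfam b).hom.hom.hom (2 * 2)).hom
  have hValg : V ≤ algebraicClasses (⨁ A).X 2 := iSup_map_le_algebraicClasses hfam WY hWY
  have hVstab : ∀ (β : 𝓞 K), ∀ z ∈ V,
      complexBetti.map (AndreProductForm.diagHom K A ι β).hom.hom.hom (2 * 2) z ∈ V :=
    fun β z hz => map_mem_iSup_map_of_comp hfam WY _
      (fun b => ⟨fun i => b i * β, diagHom_comp_liftFamily ι u₂ u₃ (g ≫ πE jE) β b⟩) hz
  -- (6) the test class `x = h_1^*(fst^*e_s ⌣ fst^*e_{sσ²} ⌣ fst^*e_{sσ⁴} ⌣ snd^*ℓ_τ) ∈ V`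
  let wY : Fin (2 * 2) → complexBetti (A j₁ ⊞ E).X 1 :=
    ![complexBetti.map (biprod.fst : A j₁ ⊞ E ⟶ A j₁).hom.hom.hom 1 (v j₁ (emb σ s 0)),
      complexBetti.map (biprod.fst : A j₁ ⊞ E ⟶ A j₁).hom.hom.hom 1 (v j₁ (emb σ s 2)),
      complexBetti.map (biprod.fst : A j₁ ⊞ E ⟶ A j₁).hom.hom.hom 1 (v j₁ (emb σ s 4)),
      complexBetti.map (biprod.snd : A j₁ ⊞ E ⟶ E).hom.hom.hom 1
        (vE (s.comp (algebraMap (IntermediateField.fixedField (Subgroup.zpowers (σ ^ 2))) K)))]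
  have hwY : cupPowOne ℂ (ComplexPoints (A j₁ ⊞ E).X) (2 * 2) wY ∈ WY := by
    refine cupPowOne_mem_weilClassesOf_of_eigen _
      (apply_eq_or_eq_neg_of_sq_eq_neg
        (s.comp (algebraMap (IntermediateField.fixedField (Subgroup.zpowers (σ ^ 2))) K)) hδE) wY fun i => ?_
    have hB : ∀ a : ℕ, ∀ m : Fin 3, a = 2 * (m : ℕ) →
        complexBetti.map (biprod.map (ι j₁ (RingOfIntegers.mapRingHom
            (algebraMap (IntermediateField.fixedField (Subgroup.zpowers (σ ^ 2))) K) δ)) (ιE δ)).hom.hom.hom 1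
          (complexBetti.map (biprod.fst : A j₁ ⊞ E ⟶ A j₁).hom.hom.hom 1 (v j₁ (emb σ s a))) =
        (s.comp (algebraMap (IntermediateField.fixedField (Subgroup.zpowers (σ ^ 2))) K))
            (δ : IntermediateField.fixedField (Subgroup.zpowers (σ ^ 2))) •
          complexBetti.map (biprod.fst : A j₁ ⊞ E ⟶ A j₁).hom.hom.hom 1 (v j₁ (emb σ s a)) := by
      intro a m ham
      rw [← htδ m, ← ham]
      exact map_biprodMap_map_fst _ _ (AndreProductForm.map_ι_apply_of_mem_eigenline (hA j₁) (hv j₁ _) _)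
    fin_cases i
    · exact hB 0 0 rfl
    · exact hB 2 1 rfl
    · exact hB 4 2 rfl
    · exact map_biprodMap_map_snd _ _ (AndreProductForm.map_ι_apply_of_mem_eigenline hE (hvE _) δ)
  have hxV : complexBetti.map (hfam 1).hom.hom.hom (2 * 2) (cupPowOne ℂ (ComplexPoints (A j₁ ⊞ E).X) (2 * 2) wY)
      ∈ V := map_mem_iSup_map hfam WY 1 hwY
  have hfam1 : hfam 1 = biprod.lift (biproduct.π A j₁ + biproduct.π A j₂ ≫ u₂ + biproduct.π A j₃ ≫ u₃)
      (biproduct.π A j₀ ≫ (g ≫ πE jE)) := liftFamily_one ι u₂ u₃ (g ≫ πE jE)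
  rw [hfam1] at hxV
  -- (7) the ordered line basis `L`, the wedge basis `Bw`, the face index `S_s`
  letI : LinearOrder (K →+* ℂ) := LinearOrder.lift' (Fintype.equivFin (K →+* ℂ)) (Fintype.equivFin _).injective
  let L : Module.Basis (Fin 4 ×ₗ (K →+* ℂ)) ℂ (complexBetti (⨁ A).X 1) :=
    (AndreProductForm.biprodBasis A v).reindex toLex
  have hL : ∀ i, L i = AndreProductForm.biprodBasis A v (ofLex i) := fun i =>
    Module.Basis.reindex_apply _ _ _
  let Bw : Module.Basis (Set.powersetCard (Fin 4 ×ₗ (K →+* ℂ)) (2 * 2)) ℂ (complexBetti (⨁ A).X (2 * 2)) :=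
    (L.exteriorPower (2 * 2)).map ((AbelianVariety.hasExteriorCohomologyH1_complexPoints (⨁ A)).equiv (2 * 2))
  let fS : Fin (2 * 2) ↪o Fin 4 ×ₗ (K →+* ℂ) :=
    OrderEmbedding.ofStrictMono (fun j : Fin 4 => toLex (j, s)) fun a b hab => by
      rw [Prod.Lex.toLex_lt_toLex]; exact Or.inl hab
  have hfS : ∀ j, fS j = toLex (j, s) := fun j => rfl
  have hfS' : Set.powersetCard.ofFinEmbEquiv.symm (Set.powersetCard.ofFinEmbEquiv fS) = fS :=
    Equiv.symm_apply_apply _ _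
  -- (8) the separating diagonal operator
  obtain ⟨β, lam, hT, huniq⟩ := exists_diag_separating_face hA hv L hL Bw rfl s fS hfS
  -- (9) the face coordinate of `x` is a non-zero determinant
  have hcoord : ∀ (z : complexBetti (⨁ A).X 1) (j : Fin (2 * 2)),
      L.coord (fS j) z = (AndreProductForm.biprodBasis A v).repr z (j, s) := by
    intro z j
    rw [Module.Basis.coord_apply, hfS]
    exact Module.Basis.repr_reindex_apply _ _ _ _
  have hrepr := WedgeCoordinates.wedgeBasis_repr_cupPowOne L (2 * 2) Bw rfl
    (fun i => complexBetti.map (biprod.lift (biproduct.π A j₁ + biproduct.π A j₂ ≫ u₂ + biproduct.π A j₃ ≫ u₃)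
      (biproduct.π A j₀ ≫ (g ≫ πE jE))).hom.hom.hom 1 (wY i)) (Set.powersetCard.ofFinEmbEquiv fS)
  rw [hfS'] at hrepr
  -- eigen-characters and coordinates of the pulled-back eigenvectors
  have hu₂line : ∀ a : ℕ, complexBetti.map u₂.hom.hom.hom 1 (v j₁ (emb σ s a)) ∈ eigenline (θ j₂) (emb σ s (a + 4)) :=
    fun a => emb_comp_sq_symm σ hσ s a ▸ hu₂eig _ _ (hv j₁ _)
  have hu₃line : ∀ a : ℕ, complexBetti.map u₃.hom.hom.hom 1 (v j₁ (emb σ s a)) ∈ eigenline (θ j₃) (emb σ s (a + 2)) :=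
    fun a => emb_comp_pow_four_symm σ hσ s a ▸ hu₃eig _ _ (hv j₁ _)
  have hz₂ : ∀ a : ℕ, (a + 4) % 6 ≠ 0 →
      (v j₂).repr (complexBetti.map u₂.hom.hom.hom 1 (v j₁ (emb σ s a))) s = 0 := fun a ha =>
    WedgeCoordinates.repr_eq_zero_of_mem_eigenline_of_ne (θ j₂) (v j₂) (hv j₂) (hu₂line a)
      (emb_ne_self σ hσ s ha).symm
  have hz₃ : ∀ a : ℕ, (a + 2) % 6 ≠ 0 →
      (v j₃).repr (complexBetti.map u₃.hom.hom.hom 1 (v j₁ (emb σ s a))) s = 0 := fun a ha =>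
    WedgeCoordinates.repr_eq_zero_of_mem_eigenline_of_ne (θ j₃) (v j₃) (hv j₃) (hu₃line a)
      (emb_ne_self σ hσ s ha).symm
  have hz₁ : ∀ a : ℕ, a % 6 ≠ 0 → (v j₁).repr (v j₁ (emb σ s a)) s = 0 := by
    intro a ha
    rw [Module.Basis.repr_self, Finsupp.single_apply, if_neg (emb_ne_self σ hσ s ha)]
  have hc₁ : (v j₁).repr (v j₁ (emb σ s 0)) s ≠ 0 := by
    rw [emb_zero, Module.Basis.repr_self, Finsupp.single_eq_same]; exact one_ne_zero
  have hc₂ : (v j₂).repr (complexBetti.map u₂.hom.hom.hom 1 (v j₁ (emb σ s 2))) s ≠ 0 := by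
    intro h0
    have hline : complexBetti.map u₂.hom.hom.hom 1 (v j₁ (emb σ s 2)) ∈ eigenline (θ j₂) s := by
      have := hu₂line 2
      rwa [show (2 + 4 : ℕ) = 6 from rfl, emb_six σ hσ] at this
    have hz := WedgeCoordinates.eq_repr_smul_of_mem_eigenline (θ j₂) (v j₂) (hv j₂) hline
    rw [h0, zero_smul] at hz
    exact (v j₁).ne_zero _ (hu₂bij.1 (by rw [hz, map_zero]))
  have hc₃ : (v j₃).repr (complexBetti.map u₃.hom.hom.hom 1 (v j₁ (emb σ s 4))) s ≠ 0 := by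
    intro h0
    have hline : complexBetti.map u₃.hom.hom.hom 1 (v j₁ (emb σ s 4)) ∈ eigenline (θ j₃) s := by
      have := hu₃line 4
      rwa [show (4 + 2 : ℕ) = 6 from rfl, emb_six σ hσ] at this
    have hz := WedgeCoordinates.eq_repr_smul_of_mem_eigenline (θ j₃) (v j₃) (hv j₃) hline
    rw [h0, zero_smul] at hz
    exact (v j₁).ne_zero _ (hu₃bij.1 (by rw [hz, map_zero]))
  -- the matrix is monomial along the slot permutation `![j₁, j₂, j₃, j₀]`
  have hslot_inj : Function.Injective (![j₁, j₂, j₃, j₀] : Fin (2 * 2) → Fin 4) :=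
    injective_vecFour h12 h13 (Ne.symm h01) h23 (Ne.symm h02) (Ne.symm h03)
  let πσ : Equiv.Perm (Fin (2 * 2)) := Equiv.ofBijective _ (Finite.injective_iff_bijective.mp hslot_inj)
  have hdet : (Matrix.of fun i j => L.coord (fS j)
      (complexBetti.map (biprod.lift (biproduct.π A j₁ + biproduct.π A j₂ ≫ u₂ + biproduct.π A j₃ ≫ u₃)
        (biproduct.π A j₀ ≫ (g ≫ πE jE))).hom.hom.hom 1 (wY i))).det ≠ 0 := by
    refine WedgeCoordinates.det_of_monomial_ne_zero _ πσ (fun i j hij => ?_) (fun i => ?_)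
    · rw [Matrix.of_apply, hcoord]
      fin_cases i
      · change _ ≠ j₁ at hij
        change (AndreProductForm.biprodBasis A v).repr (complexBetti.map _ 1 (complexBetti.map _ 1 (v j₁ (emb σ s 0)))) _ = 0
        rw [repr_map_lift_map_fst, if_neg hij, hz₂ 0 (by decide), hz₃ 0 (by decide)]
        simp
      · change _ ≠ j₂ at hij
        change (AndreProductForm.biprodBasis A v).repr (complexBetti.map _ 1 (complexBetti.map _ 1 (v j₁ (emb σ s 2)))) _ = 0
        rw [repr_map_lift_map_fst, hz₁ 2 (by decide), hz₃ 2 (by decide), if_neg hij]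
        simp
      · change _ ≠ j₃ at hij
        change (AndreProductForm.biprodBasis A v).repr (complexBetti.map _ 1 (complexBetti.map _ 1 (v j₁ (emb σ s 4)))) _ = 0
        rw [repr_map_lift_map_fst, hz₁ 4 (by decide), hz₂ 4 (by decide), if_neg hij]
        simp
      · change _ ≠ j₀ at hij
        change (AndreProductForm.biprodBasis A v).repr (complexBetti.map _ 1 (complexBetti.map _ 1 (vE _))) _ = 0
        rw [repr_map_lift_map_snd, if_neg hij]
    · rw [Matrix.of_apply, hcoord]
      fin_cases i
      · change (AndreProductForm.biprodBasis A v).repr (complexBetti.map _ 1 (complexBetti.map _ 1 (v j₁ (emb σ s 0)))) (j₁, s) ≠ 0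
        rw [repr_map_lift_map_fst, if_pos rfl, hz₂ 0 (by decide), hz₃ 0 (by decide)]
        simpa using hc₁
      · change (AndreProductForm.biprodBasis A v).repr (complexBetti.map _ 1 (complexBetti.map _ 1 (v j₁ (emb σ s 2)))) (j₂, s) ≠ 0
        rw [repr_map_lift_map_fst, hz₁ 2 (by decide), hz₃ 2 (by decide), if_pos rfl, if_neg (Ne.symm h12)]
        simpa using hc₂
      · change (AndreProductForm.biprodBasis A v).repr (complexBetti.map _ 1 (complexBetti.map _ 1 (v j₁ (emb σ s 4)))) (j₃, s) ≠ 0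
        rw [repr_map_lift_map_fst, hz₁ 4 (by decide), hz₂ 4 (by decide), if_pos rfl, if_neg (Ne.symm h13),
          if_neg (Ne.symm h23)]
        simpa using hc₃
      · change (AndreProductForm.biprodBasis A v).repr (complexBetti.map _ 1 (complexBetti.map _ 1 (vE _))) (j₀, s) ≠ 0
        rw [repr_map_lift_map_snd, if_pos rfl]
        exact hjE
  have hx_cup : complexBetti.map (biprod.lift (biproduct.π A j₁ + biproduct.π A j₂ ≫ u₂ + biproduct.π A j₃ ≫ u₃)
        (biproduct.π A j₀ ≫ (g ≫ πE jE))).hom.hom.hom (2 * 2) (cupPowOne ℂ (ComplexPoints (A j₁ ⊞ E).X) (2 * 2) wY) =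
      cupPowOne ℂ (ComplexPoints (⨁ A).X) (2 * 2) (fun i => complexBetti.map
        (biprod.lift (biproduct.π A j₁ + biproduct.π A j₂ ≫ u₂ + biproduct.π A j₃ ≫ u₃)
          (biproduct.π A j₀ ≫ (g ≫ πE jE))).hom.hom.hom 1 (wY i)) :=
    map_cupPowOne _ (2 * 2) wY
  have hxSs : Bw.repr (complexBetti.map (biprod.lift (biproduct.π A j₁ + biproduct.π A j₂ ≫ u₂ + biproduct.π A j₃ ≫ u₃)
        (biproduct.π A j₀ ≫ (g ≫ πE jE))).hom.hom.hom (2 * 2) (cupPowOne ℂ (ComplexPoints (A j₁ ⊞ E).X) (2 * 2) wY))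
      (Set.powersetCard.ofFinEmbEquiv fS) ≠ 0 := by
    rw [hx_cup, hrepr]; exact hdet
  -- (10) the face monomial `Bw S_s` lies in `V`, hence is algebraic; rescale to the given `y`
  have hBwV : Bw (Set.powersetCard.ofFinEmbEquiv fS) ∈ V :=
    InvariantComponent.basis_mem_of_invariant_of_repr_ne_zero Bw
      (complexBetti.map (AndreProductForm.diagHom K A ι β).hom.hom.hom (2 * 2)).hom lam hT V (hVstab β) hxV _
      (fun S hS => huniq S hS) hxSs
  have hBwSs : Bw (Set.powersetCard.ofFinEmbEquiv fS) = cupPowOne ℂ (ComplexPoints (⨁ A).X) (2 * 2)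
      (fun j => complexBetti.map (biproduct.π A j).hom.hom.hom 1 (v j s)) := by
    rw [WedgeCoordinates.wedgeBasis_apply L (2 * 2) Bw rfl _, hfS']
    congr 1
    funext j
    rw [hfS j, hL]
    exact AndreProductForm.biprodBasis_apply A v (j, s)
  have halg : cupPowOne ℂ (ComplexPoints (⨁ A).X) (2 * 2)
      (fun j => complexBetti.map (biproduct.π A j).hom.hom.hom 1 (v j s)) ∈ algebraicClasses (⨁ A).X 2 := by
    rw [← hBwSs]; exact hValg hBwV
  have hyc : ∀ j, y j = (v j).repr (y j) s • v j s := fun j =>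
    WedgeCoordinates.eq_repr_smul_of_mem_eigenline (θ j) (v j) (hv j) (hy j)
  have hcup : cupPowOne ℂ (ComplexPoints (⨁ A).X) (2 * 2)
        (fun j => complexBetti.map (biproduct.π A j).hom.hom.hom 1 (y j)) =
      (∏ j, (v j).repr (y j) s) • cupPowOne ℂ (ComplexPoints (⨁ A).X) (2 * 2)
        (fun j => complexBetti.map (biproduct.π A j).hom.hom.hom 1 (v j s)) := by
    have e : (fun j => complexBetti.map (biproduct.π A j).hom.hom.hom 1 (y j)) =
        fun j => (v j).repr (y j) s • complexBetti.map (biproduct.π A j).hom.hom.hom 1 (v j s) := by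
      funext j
      conv_lhs => rw [hyc j]
      rw [map_smul]
    rw [e, MultilinearMap.map_smul_univ]
  rw [hcup]
  exact Submodule.smul_mem _ _ halg

end Main

/-! ## L6 (F-branch) and T1 for faces -/

section WeilLine

/-- **L6 (F-branch): the `K`-Weil line of an (F)-pattern slot product is algebraic, given Markman.**
[cite: Markman2025SurveySecant, Thm. 1.2] [cite: Milne2020HodgeClassesAV, 2.1–2.2 and Theorem 1] -/
theorem weilLineClasses_le_algebraicClasses_of_patternF
    (hW4 : Markman2025_weilClasses_algebraic_abelianFourfold) (hR : DeligneMilne1982_Thm_6_20_full)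
    (h₃ : Literature.NumberTheory.Automorphic.PicardCM.CMAbelianVarietyRealised)
    (h6 : Module.finrank ℚ K = 6) (σ : K ≃ₐ[ℚ] K) (hσ : orderOf σ = 6) (h3 : σ ^ 3 = conjGal)
    {A : Fin 4 → AbelianVariety ℂ} {ι : ∀ j, 𝓞 K →+* End (A j)}
    {θ : ∀ j, K →+* Module.End ℂ (complexBetti (A j).X 1)} {Ψ : Fin 4 → CMType K}
    (hA : ∀ j, IsCMTypeRealisation (Ψ j) (A j) (ι j) (θ j))
    {j₀ j₁ j₂ j₃ : Fin 4} (hnd : [j₀, j₁, j₂, j₃].Nodup)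
    (hΨ₀ : cmTypeMap (σ ^ 2).toRingEquiv (Ψ j₀) = Ψ j₀)
    (hΨ₂ : Ψ j₂ = cmTypeMap (σ ^ 2).toRingEquiv (Ψ j₁))
    (hΨ₃ : Ψ j₃ = cmTypeMap (σ ^ 4).toRingEquiv (Ψ j₁))
    (hsum : ∀ s : K →+* ℂ, {j : Fin 4 | s ∈ (Ψ j).1}.ncard = 2) :
    weilLineClasses A ι (2 * 2) ≤ algebraicClasses (⨁ A).X 2 := by
  have hv' : ∀ j, ∃ w : Module.Basis (K →+* ℂ) ℂ (complexBetti (A j).X 1), ∀ σ', w σ' ∈ eigenline (θ j) σ' :=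
    fun j => AndreProductForm.exists_eigenbasis (hA j)
  choose v hv using hv'
  change weilLineClasses A ι 4 ≤ _
  rw [WeilLineMonomial.weilLineClasses_eq_iSup_span_monomial hA hv]
  refine iSup_le fun s => (Submodule.span_singleton_le_iff_mem _ _).2 ?_
  have h := cupPowOne_eigenline_mem_algebraicClasses_of_markman hW4 hR h₃ h6 σ hσ h3 hA hnd hΨ₀ hΨ₂ hΨ₃ hsum s
    (fun j => v j s) (fun j => hv j s)
  rw [WeilLineMonomial.monomial_def]
  simpa only [AndreProductForm.biprodBasis_apply] using h

/-- **T1 for faces: the `K`-Weil line `W_K(P(f)) ⊗ ℂ` of the corner product of every rank-four face of a Galois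
sextic CM field is algebraic, given Markman's fourfold theorem** (mod `hR`, `h₃`) — the hypothesis of seat b07's
`Model.weilFaceAlgebraic_of_weilLineClasses_le`. [cite: Markman2025SurveySecant, Thm. 1.2] [cite: Andre1992HodgeCM, p. 2] -/
theorem weilLineClasses_corner_le_algebraicClasses_of_markman
    (hW4 : Markman2025_weilClasses_algebraic_abelianFourfold) (hR : DeligneMilne1982_Thm_6_20_full)
    (h₃ : Literature.NumberTheory.Automorphic.PicardCM.CMAbelianVarietyRealised)
    (h6 : Module.finrank ℚ K = 6) (f : Face K)
    {A : Fin 4 → AbelianVariety ℂ} {ι : ∀ j, 𝓞 K →+* End (A j)}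
    {θ : ∀ j, K →+* Module.End ℂ (complexBetti (A j).X 1)}
    (hA : ∀ j, IsCMTypeRealisation (f.corner j) (A j) (ι j) (θ j)) :
    weilLineClasses A ι (2 * 2) ≤ algebraicClasses (⨁ A).X 2 := by
  obtain ⟨σ, hσ, h3⟩ := exists_generator (K := K) h6
  obtain ⟨j₀, j₁, j₂, j₃, hnd, h0, -, h2, h4⟩ := face_corner_pattern σ h6 hσ h3 f
  exact weilLineClasses_le_algebraicClasses_of_patternF hW4 hR h₃ h6 σ hσ h3 hA hnd h0 h2 h4
    ((sumTwo_iff_ncard_eq_two f.corner).1 (sumTwo_corner f))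

/-- Pointwise form (the `hW` shape of `Model.weilFaceAlgebraic_of_weilLineClasses`): every class of the `K`-Weil
line of the corner product of a face is algebraic (rationality and Hodge type are not even needed).
[cite: Markman2025SurveySecant, Thm. 1.2] [cite: Andre1992HodgeCM, p. 2] -/
theorem mem_algebraicClasses_of_mem_weilLineClasses_corner_of_markman
    (hW4 : Markman2025_weilClasses_algebraic_abelianFourfold) (hR : DeligneMilne1982_Thm_6_20_full)
    (h₃ : Literature.NumberTheory.Automorphic.PicardCM.CMAbelianVarietyRealised)
    (h6 : Module.finrank ℚ K = 6) (f : Face K)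
    {A : Fin 4 → AbelianVariety ℂ} {ι : ∀ j, 𝓞 K →+* End (A j)}
    {θ : ∀ j, K →+* Module.End ℂ (complexBetti (A j).X 1)}
    (hA : ∀ j, IsCMTypeRealisation (f.corner j) (A j) (ι j) (θ j))
    (t : complexBetti (⨁ A).X (2 * 2)) (_ht : IsRationalClass t)
    (_hH : IsOfHodgeType (⨁ A).dim (⨁ A).X (2 * 2) 2 2 t) (hW : t ∈ weilLineClasses A ι (2 * 2)) :
    t ∈ algebraicClasses (⨁ A).X 2 :=
  weilLineClasses_corner_le_algebraicClasses_of_markman hW4 hR h₃ h6 f hA hW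

end WeilLine

end Summit.HodgeConjecture.CorCM.CyclicSextic

end
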